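import Summits.HodgeConjecture.HodgeConjecture.Theorems.F0LD1ThetaSliceBricks
import Summits.HodgeConjecture.HodgeConjecture.Theorems.F0LD1ThetaClassLevelExists
import Summits.HodgeConjecture.HodgeConjecture.Theorems.F0LD1ThetaClassFinSliceFinite
import Summits.HodgeConjecture.HodgeConjecture.Theorems.F0LD1ThetaClassFinEquivariancePin
import Summits.HodgeConjecture.HodgeConjecture.Theorems.F0LD1OrbitAverageFixed
import Mathlib.Analysis.InnerProductSpace.Projection.Basic
import Mathlib.Topology.Algebra.OpenSubgroup
import HarnessLib

-- statements over the theta-kernel datum elaborate to very large types; elaborate sequentially (as in the ★ kit lineage)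
set_option Elab.async false

/-!
# Crux `HLiu418`, line LD1 — brick (Gβ-L) `FiniteLevel` HOLDS (organ payment, LD1-p01 (g3))

`theorem finiteLevel_holds : F0LD1ThetaSliceOfBricks.FiniteLevel` — the FOLDED head constant of ★ `Theorems.F0LD1ThetaSliceBricks`
(junction v4 of LD1-plan (g2); referee ruling LD-ref1 (g2) 09:57:23Z).

THE ROAD (no Bochner integral).  Fix the frame and a finite datum `Φ_f⁰ ∈ 𝒮((𝔸_{L⁺,f})^{n′})`, `n′ = 2`, read back to the `2 × 1` currency
`Ψ⁰ := (R_e^f)⁻¹ Φ_f⁰` (★ `finSBReindex`).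
* LEVEL: a compact open `K′ ≤ U(diag dV)(𝔸_{L⁺,f})` with `ω_f(k, 1) Ψ⁰ = Ψ⁰`, `k ∈ K′` (★ `F0LD1ThetaClassLevelExists`); the level set
  `S := {Φ_f : ω_f(k,1) (R_e^f)⁻¹ Φ_f = (R_e^f)⁻¹ Φ_f ∀ k ∈ K′}`.
* OPERATOR: `K′` acts on `L²([U(H)], μ)` through `k ↦ R(ι_f (g_f k g_f⁻¹))` (the letters' finite transport ★ `finAdelicCongr … g ht hg` composed
  with ★ `finAdelicToAdelic`); `A := P_F`, the ORTHOGONAL PROJECTION onto the closed subspace `F` of `K′`-fixed vectors (§0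
  `exists_fixedSubmodule`).
* (i) `A` maps every closed `R`-invariant `Q` into itself — §0 `starProjection_apply_mem_closedSubrep`: `R` is unitary (★ `isUnitary_rightRegular`),
  so `Q ⊕ Qᗮ` is `R`-stable and the `Q`-projection of a fixed vector is fixed; then the `Qᗮ`-component `b` of `p = P_F v` (`v ∈ Q`) lies in
  `F ∩ Qᗮ`, whence `‖b‖² = ⟨p, b⟩ = ⟨v, b⟩ = 0`.
* (ii) `A [θ_{φ ⊗ Φ_f}] = [θ_{φ ⊗ Φ_f″}]` with `Φ_f″ := R_e^f ((1∕m) Σ_{q ∈ K′∕K″} ω_f(q̃,1) Ψ) ∈ S`, `K″ := K′ ∩ Stab(Ψ)` (open, so of finite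
  index `m` in the compact `K′` — Mathlib `Subgroup.quotient_finite_of_isOpen`): §0 `starProjection_eq_orbitAverage` (for a unitary action, the
  projection onto the fixed space of a vector with finite-index stabiliser IS its finite orbit average — it is fixed by ★
  `F0LD1OrbitAverageFixed.apply_orbitAverage_eq`, and `v −` it is `⊥ F` by unitarity), the finite-factor EQUIVARIANCE under the pin ★
  `F0LD1ThetaClassFinEquivariancePin.rightRegular_finAdelicToAdelic_toLp_lineThetaLift_tmul_finSBReindex`, and linearity of the class in the finite
  datum (★ `toLp_lineThetaLift_add_left ∕ _smul_left`); `Φ_f″ ∈ S` again by ★ `apply_orbitAverage_eq` (on `𝒮`, for `ω_f`).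
* (iii) a class of level `S` is `K′`-fixed (★ `…_of_fixed`), hence fixed by `P_F`.
* (iv) `span {[θ^{μ_W}_{h_β ⊗ Φ_f}] : Φ_f ∈ S}` is finite-dimensional: it lies in the span of ★
  `F0LD1ThetaClassFinSliceFinite.finiteDimensional_span_toLp_lineThetaLift_tmul_of_fixed` (local admissibility of the Weil representation, `n′ ≥ 2`).

HONEST LABEL. HC_CM is proved only modulo the 7 printed citations (2 remaining: hLiu418 = stmt-HodgeConjecture-24832,
h413 = stmt-HodgeConjecture-24833) until rung 0 closes; this file discharges one in-house brick of line LD1 and nothing printed; count-neutral.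
References (prose locators): Borel–Jacquet 1979 §4.6; Bernstein–Zelevinsky 1976 §2.1; Mœglin–Vignéras–Waldspurger 1987 Chap. 2 I.4, Chap. 3 IV.4;
Liu 2021 Def. 4.11, proof of Prop. 4.13 Case 1; Rallis 1984 proof of Thm. 1.2.2.
-/

set_option autoImplicit false
set_option linter.dupNamespace false

noncomputable section

open NumberField NumberField.InfinitePlace MeasureTheory IsDedekindDomain
open scoped Matrix Kronecker ComplexOrder ENNReal TensorProduct SchwartzMap InnerProductSpace ComplexConjugate Classical
open Literature.NumberTheory.Automorphic Literature.NumberTheory.Automorphic.UnitaryGroup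
open Literature.NumberTheory.Automorphic.UnitaryGroup.CotangentForms (toQuotFun)
open Literature.NumberTheory.Automorphic.UnitaryCurveForms
open Literature.NumberTheory.Automorphic.Liu2021 Literature.NumberTheory.Automorphic.Liu2021.Def411WeilCarriers
open Literature.NumberTheory.Automorphic.Liu2021.Def411WeilCarriersDoubling
open Literature.NumberTheory.Automorphic.Liu2021.CinfThetaTorus
open Literature.NumberTheory.GaloisRepresentations Literature.NumberTheory.Automorphic.IdeleClassGroup
open Literature.NumberTheory.GelbartRogawski1991 Literature.NumberTheory.GelbartRogawski1991.UnitaryDualPair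
open Literature.NumberTheory.GelbartRogawski1991.UnitaryDualPair.WeilCoinv
open Literature.NumberTheory.GelbartRogawski1991.GRConstruction
open Literature.NumberTheory.Weil1964
open Literature.RepresentationTheory.Liu2021 Literature.RepresentationTheory.HarrisKudlaSweet1996
open Literature.RepresentationTheory.HeisenbergGroup Literature.Analysis.SegalBargmann
open Literature.RepresentationTheory.KonnoKonno2007 Literature.RepresentationTheory.KonnoKonno2007.RealDualPair
open Literature.RepresentationTheory.CompactGroups
open Literature.NumberTheory.Rogawski1990
open Summit.HodgeConjecture.HodgeConjecture.Cruxes.HLiu418.F0LD1ThetaTransportKit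
open Summit.HodgeConjecture.HodgeConjecture.Cruxes.HLiu418.F0LD2ThetaTensorClasses
open Summit.HodgeConjecture.HodgeConjecture.Cruxes.HLiu418.F0LD2FrameTransportPin
open Summit.HodgeConjecture.HodgeConjecture.Cruxes.HLiu418.F0LD1ThetaGermDefs
open Summit.HodgeConjecture.HodgeConjecture.Cruxes.HLiu418.F0LD1ThetaClassLevelExists
open Summit.HodgeConjecture.HodgeConjecture.Cruxes.HLiu418.F0LD1ThetaClassFinSliceFinite
open Summit.HodgeConjecture.HodgeConjecture.Cruxes.HLiu418.F0LD1ThetaClassFinEquivariancePin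
open Summit.HodgeConjecture.HodgeConjecture.Cruxes.HLiu418.F0LD1OrbitAverageFixed

namespace Summit.HodgeConjecture.HodgeConjecture.Cruxes.HLiu418.F0LD1ThetaSliceFiniteLevel

/-! ## §0 Generic: the orthogonal projection onto the fixed space of a unitary action -/

section Generic

variable {G : Type*} [Group G] {E : Type*} [NormedAddCommGroup E] [InnerProductSpace ℂ E] [CompleteSpace E]
  (π : ContRepresentation ℂ G E)

omit [CompleteSpace E] in
/-- **The fixed space of a family of bounded operators is a closed submodule** (an intersection of equalisers). [folklore] -/
theorem exists_fixedSubmodule {ι : Type*} (T : ι → (E →L[ℂ] E)) :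
    ∃ F : Submodule ℂ E, IsClosed (F : Set E) ∧ ∀ v, v ∈ F ↔ ∀ i, T i v = v := by
  refine ⟨⨅ i, LinearMap.eqLocus (T i : E →ₗ[ℂ] E) LinearMap.id, ?_, fun v => ?_⟩
  · rw [Submodule.coe_iInf]
    exact isClosed_iInter fun i => isClosed_eq (T i).continuous continuous_id
  · simp only [Submodule.mem_iInf, LinearMap.mem_eqLocus, ContinuousLinearMap.coe_coe, LinearMap.id_coe, id_eq]

variable {π}

/-- **The projection onto the fixed space of a unitary action preserves every closed invariant subspace.**  For `π` unitary, `Q` a closed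
`π`-invariant subspace and `F` the space of vectors fixed by the operators `π (γ i)`: `P_F Q ≤ Q`.  (The `Q`-projection of a fixed vector is fixed,
since `Q` and `Qᗮ` are both invariant; so the `Qᗮ`-component `b` of `p = P_F v` is fixed, and `‖b‖² = ⟨p, b⟩ = ⟨v, b⟩ = 0` for `v ∈ Q`.)
[cite: Dixmier1977, §13.1.2] [cite: BorelJacquet1979, §4.6] -/
theorem starProjection_apply_mem_closedSubrep (hπ : π.IsUnitary) {ι : Type*} (γ : ι → G)
    (F : Submodule ℂ E) [F.HasOrthogonalProjection] (hF : ∀ v, v ∈ F ↔ ∀ i, π (γ i) v = v)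
    (Q : ContRepresentation.ClosedSubrep π) {v : E} (hv : v ∈ Q) : F.starProjection v ∈ Q := by
  haveI : CompleteSpace Q.toSubmodule := Q.isClosed.completeSpace_coe
  -- the `Q`-projection of a fixed vector is fixed
  have hfix : ∀ u ∈ F, Q.toSubmodule.starProjection u ∈ F := fun u hu => by
    rw [hF] at hu ⊢
    intro i
    symm
    refine Submodule.eq_starProjection_of_mem_orthogonal (Q.apply_mem (γ i) (Q.toSubmodule.starProjection_apply_mem u)) ?_
    have h : u - π (γ i) (Q.toSubmodule.starProjection u) = π (γ i) (u - Q.toSubmodule.starProjection u) := by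
      rw [map_sub, hu i]
    rw [h]
    exact (Q.orthogonal hπ).apply_mem (γ i) (Q.toSubmodule.sub_starProjection_mem_orthogonal u)
  -- the `Qᗮ`-component `b` of `p := P_F v`
  have hpF : F.starProjection v ∈ F := F.starProjection_apply_mem v
  have hbF : F.starProjection v - Q.toSubmodule.starProjection (F.starProjection v) ∈ F :=
    F.sub_mem hpF (hfix _ hpF)
  have hbQ : F.starProjection v - Q.toSubmodule.starProjection (F.starProjection v) ∈ Q.toSubmoduleᗮ :=
    Q.toSubmodule.sub_starProjection_mem_orthogonal _
  -- `⟨b, p⟩ = ⟨b, v⟩ - ⟨b, v - p⟩ = 0`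
  have h1 : ⟪F.starProjection v - Q.toSubmodule.starProjection (F.starProjection v), F.starProjection v⟫_ℂ = 0 := by
    have hv0 : ⟪F.starProjection v - Q.toSubmodule.starProjection (F.starProjection v), v⟫_ℂ = 0 :=
      Submodule.inner_left_of_mem_orthogonal (K := Q.toSubmodule) hv hbQ
    have hvp : ⟪F.starProjection v - Q.toSubmodule.starProjection (F.starProjection v), v - F.starProjection v⟫_ℂ = 0 :=
      Submodule.inner_right_of_mem_orthogonal hbF (F.sub_starProjection_mem_orthogonal v)
    have e : ⟪F.starProjection v - Q.toSubmodule.starProjection (F.starProjection v), v⟫_ℂ -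
        ⟪F.starProjection v - Q.toSubmodule.starProjection (F.starProjection v), v - F.starProjection v⟫_ℂ =
        ⟪F.starProjection v - Q.toSubmodule.starProjection (F.starProjection v), F.starProjection v⟫_ℂ := by
      rw [← inner_sub_right, sub_sub_cancel]
    rw [← e, hv0, hvp, sub_zero]
  -- `⟨b, p⟩ = ⟨b, b⟩ + ⟨b, P_Q p⟩ = ‖b‖²`
  have h2 : ⟪F.starProjection v - Q.toSubmodule.starProjection (F.starProjection v),
        F.starProjection v - Q.toSubmodule.starProjection (F.starProjection v)⟫_ℂ +
      ⟪F.starProjection v - Q.toSubmodule.starProjection (F.starProjection v),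
        Q.toSubmodule.starProjection (F.starProjection v)⟫_ℂ =
      ⟪F.starProjection v - Q.toSubmodule.starProjection (F.starProjection v), F.starProjection v⟫_ℂ := by
    rw [← inner_add_right, sub_add_cancel]
  rw [Submodule.inner_left_of_mem_orthogonal (K := Q.toSubmodule) (Q.toSubmodule.starProjection_apply_mem _) hbQ,
    add_zero, h1, inner_self_eq_zero, sub_eq_zero] at h2
  rw [h2]
  exact Q.toSubmodule.starProjection_apply_mem _

/-- **For a unitary action, the projection onto the fixed space of a vector with finite-index stabiliser is its finite orbit average**:
if `Γ` acts through `π ∘ γ`, `F` is the space of `Γ`-fixed vectors and `S ≤ Γ` has finite index and fixes `x`, then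
`P_F x = (1 ∕ [Γ:S]) Σ_{q ∈ Γ∕S} π(γ q̃) x` (the average is `Γ`-fixed — ★ `F0LD1OrbitAverageFixed.apply_orbitAverage_eq` — and `x −` it is orthogonal
to `F` because `⟨u, π(g) x⟩ = ⟨π(g) u, π(g) x⟩ = ⟨u, x⟩` for fixed `u`). [cite: BernsteinZelevinsky1976, §2.1] [cite: BorelJacquet1979, §4.6] -/
theorem starProjection_eq_orbitAverage (hπ : π.IsUnitary) {Γ : Type*} [Group Γ] (γ : Γ →* G)
    (F : Submodule ℂ E) [F.HasOrthogonalProjection] (hF : ∀ v, v ∈ F ↔ ∀ k : Γ, π (γ k) v = v)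
    (S : Subgroup Γ) [Fintype (Γ ⧸ S)] {x : E} (hS : ∀ s ∈ S, π (γ s) x = x) :
    F.starProjection x = ((Fintype.card (Γ ⧸ S) : ℂ))⁻¹ • ∑ q : Γ ⧸ S, π (γ q.out) x := by
  have hcard : (Fintype.card (Γ ⧸ S) : ℂ) ≠ 0 :=
    Nat.cast_ne_zero.2 (Fintype.card_pos_iff.2 ⟨QuotientGroup.mk (s := S) 1⟩).ne'
  have hS' : ∀ s ∈ S, (π.toRepresentation.comp γ) s x = x := hS
  refine Submodule.eq_starProjection_of_mem_orthogonal ?_ ?_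
  · -- the average is `Γ`-fixed
    rw [hF]
    intro k
    exact apply_orbitAverage_eq (π.toRepresentation.comp γ) S hS' ((Fintype.card (Γ ⧸ S) : ℂ))⁻¹ k
  · -- `x -` average `⊥ F`
    rw [Submodule.mem_orthogonal]
    intro u hu
    rw [hF] at hu
    have hterm : ∀ q : Γ ⧸ S, ⟪u, π (γ q.out) x⟫_ℂ = ⟪u, x⟫_ℂ := fun q => by
      conv_lhs => rw [← hu q.out]
      exact hπ.inner_map_map _ u x
    rw [inner_sub_right, inner_smul_right, inner_sum]
    simp_rw [hterm]
    rw [Finset.sum_const, Finset.card_univ, nsmul_eq_mul, ← mul_assoc, inv_mul_cancel₀ hcard, one_mul, sub_self]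

end Generic

/-! ## §1 (Gβ-L) `FiniteLevel` holds -/

set_option maxHeartbeats 1600000 in
/-- **(Gβ-L) `FiniteLevel` HOLDS** (folded head): for every finite datum `Φ_f⁰` the level set `S` of its level `K′` (★ LevelExists) and the
orthogonal projection `A := P_F` onto the `K′`-fixed vectors of `L²([U(H)], μ)` (`K′` acting through the pinned finite transport) satisfy
(i) invariance of closed `R`-stable subspaces (§0, unitarity), (ii) `A [θ_{φ ⊗ Φ_f}] = [θ_{φ ⊗ Φ_f″}]` with `Φ_f″ ∈ S` the finite coset average
(§0 + ★ FinEquivariancePin + ★ OrbitAverageFixed), (iii) `A` fixes the classes of level `S`, (iv) the Hermite slices over `S` are finite-dimensional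
(★ FinSliceFinite). [cite: BorelJacquet1979, §4.6] [cite: BernsteinZelevinsky1976, §2.1] [cite: MoeglinVignerasWaldspurger1987, Chap. 3 IV.4]
[cite: Liu2021, Def. 4.11; proof of Prop. 4.13 Case 1] [cite: Rallis1984, proof of Thm. 1.2.2 p. 356] -/
theorem finiteLevel_holds : F0LD1ThetaSliceOfBricks.FiniteLevel := by
  intro L _ _ _ ι H dV hdV hdV0 t ht g hg _hsig hdef hdeg μ _ n' e₁ lam hlam _hw ιA hpin _ a' ξ Φf₀
  haveI : CompactSpace (adelicGroupData (↥(maximalRealSubfield L)) L (IsCMField.complexConj L) 2 H).automorphicQuotient :=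
    (UnitaryGroup.exists_infinitePlace_ne L hdeg ι).elim fun τ hτ =>
      UnitaryGroup.compactSpace_adelicGroupData_automorphicQuotient L 2 H
        (UnitaryGroup.anisotropic_of_formCongr_smul_eq_of_posDef L 2 H dV t ht g hg τ (hdef τ hτ))
  have hT : Continuous ιA ∧ ∀ ⦃γ : (adelicGroupData (↥(maximalRealSubfield L)) L (IsCMField.complexConj L) 2 H).Adelic⦄,
      γ ∈ (UnitaryGroup.toAdelic (↥(maximalRealSubfield L)) L (IsCMField.complexConj L) 2 H).range →
        ιA γ ∈ (UnitaryGroup.toAdelic (↥(maximalRealSubfield L)) L (IsCMField.complexConj L) 2 (Matrix.diagonal dV)).range :=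
    ⟨continuous_of_pin L 2 H dV g ιA hpin, fun _ hγ => mem_range_toAdelic_of_pin L 2 H dV t ht g hg ιA hpin hγ⟩
  letI : MeasurableSpace (↥(UnitaryGroup.adelic (↥(maximalRealSubfield L)) L (IsCMField.complexConj L) 1 (JW (↥(maximalRealSubfield L)) L a')) ⧸ (UnitaryGroup.toAdelic (↥(maximalRealSubfield L)) L (IsCMField.complexConj L) 1 (JW (↥(maximalRealSubfield L)) L a')).range) := borel _
  haveI : BorelSpace (↥(UnitaryGroup.adelic (↥(maximalRealSubfield L)) L (IsCMField.complexConj L) 1 (JW (↥(maximalRealSubfield L)) L a')) ⧸ (UnitaryGroup.toAdelic (↥(maximalRealSubfield L)) L (IsCMField.complexConj L) 1 (JW (↥(maximalRealSubfield L)) L a')).range) := ⟨rfl⟩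
  haveI := normal_range_toAdelic_JW L a'
  -- `n' = 2`
  have hn' : 2 ≤ n' := by
    have h := Fintype.card_congr e₁
    simp only [Fintype.card_prod, Fintype.card_fin] at h
    omega
  -- the level `K'` of `Ψ⁰ := (R_e^f)⁻¹ Φ_f⁰`
  obtain ⟨K', hK'o, hK'c, hK'⟩ := exists_isOpen_isCompact_forall_finPairRep_eq_self L 2 e₁ dV hdV hdV0 lam hlam a'
    ((finSBReindex (↥(maximalRealSubfield L)) e₁).symm Φf₀)
  haveI : CompactSpace K' := isCompact_iff_compactSpace.mp hK'c
  -- `K'` acts on `L²([U(H)], μ)` through the pinned finite transport `k ↦ ι_f (g_f k g_f⁻¹)`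
  obtain ⟨γ, hγ⟩ : ∃ γ : K' →* (adelicGroupData (↥(maximalRealSubfield L)) L (IsCMField.complexConj L) 2 H).Adelic,
      ∀ k : K', γ k = finAdelicToAdelic (↥(maximalRealSubfield L)) L (IsCMField.complexConj L) 2 H
        (finAdelicCongr (↥(maximalRealSubfield L)) L (IsCMField.complexConj L) g ht hg
          (k : finAdelic (↥(maximalRealSubfield L)) L (IsCMField.complexConj L) 2 (Matrix.diagonal dV))) :=
    ⟨((finAdelicToAdelic (↥(maximalRealSubfield L)) L (IsCMField.complexConj L) 2 H).comp
      (finAdelicCongr (↥(maximalRealSubfield L)) L (IsCMField.complexConj L) g ht hg).toMulEquiv.toMonoidHom).comp K'.subtype,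
      fun _ => rfl⟩
  -- the fixed space `F` and the projection `A := P_F`
  obtain ⟨F, hFc, hF⟩ := exists_fixedSubmodule fun k : K' =>
    (adelicGroupData (↥(maximalRealSubfield L)) L (IsCMField.complexConj L) 2 H).rightRegular μ (γ k)
  haveI : CompleteSpace F := hFc.completeSpace_coe
  have hU := (adelicGroupData (↥(maximalRealSubfield L)) L (IsCMField.complexConj L) 2 H).isUnitary_rightRegular μ
  -- EQUIVARIANCE of the pure-tensor classes under `γ` (★ FinEquivariancePin, at `k_H := g_f k g_f⁻¹`)
  have hequiv : ∀ (hρ : HasThetaMajorants fun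
          (p : ↥(UnitaryGroup.adelic (↥(maximalRealSubfield L)) L (IsCMField.complexConj L) 2 (Matrix.diagonal dV)) × ↥(UnitaryGroup.adelic (↥(maximalRealSubfield L)) L (IsCMField.complexConj L) 1 (JW (↥(maximalRealSubfield L)) L a'))) (Φ : piSchwartzBruhat (↥(maximalRealSubfield L)) (Fin n')) =>
            pairRep (↥(maximalRealSubfield L)) L (IsCMField.complexConj L) 2 1 e₁ (Matrix.diagonal dV) (JW (↥(maximalRealSubfield L)) L a')
              (chiSplittingLine L e₁ dV hdV hdV0 (toHeckeCharacter L lam) (isUnitary_toHeckeCharacter L lam)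
                ((isOscillatorChar_toHeckeCharacter_iff lam).mpr hlam) (TW (↥(maximalRealSubfield L)) a')
                (isUnit_det_TW (↥(maximalRealSubfield L)) a') (JW (↥(maximalRealSubfield L)) L a') (JW_eq (↥(maximalRealSubfield L)) L a'))
              p Φ)
      (μW : Measure (↥(UnitaryGroup.adelic (↥(maximalRealSubfield L)) L (IsCMField.complexConj L) 1 (JW (↥(maximalRealSubfield L)) L a')) ⧸ (UnitaryGroup.toAdelic (↥(maximalRealSubfield L)) L (IsCMField.complexConj L) 1 (JW (↥(maximalRealSubfield L)) L a')).range))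
      [IsFiniteMeasure μW] [SMulInvariantMeasure ↥(UnitaryGroup.adelic (↥(maximalRealSubfield L)) L (IsCMField.complexConj L) 1 (JW (↥(maximalRealSubfield L)) L a')) (↥(UnitaryGroup.adelic (↥(maximalRealSubfield L)) L (IsCMField.complexConj L) 1 (JW (↥(maximalRealSubfield L)) L a')) ⧸ (UnitaryGroup.toAdelic (↥(maximalRealSubfield L)) L (IsCMField.complexConj L) 1 (JW (↥(maximalRealSubfield L)) L a')).range) μW]
      (φ : 𝓢((Fin n' → mixedEmbedding.mixedSpace ↥(maximalRealSubfield L)), ℂ)) (k : K') (Ψ : FinSB (↥(maximalRealSubfield L)) (Fin 2 × Fin 1)),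
      (adelicGroupData (↥(maximalRealSubfield L)) L (IsCMField.complexConj L) 2 H).rightRegular μ (γ k)
        (MemLp.toLp _ (memLp_toQuotFun_lineThetaLift L 2 H e₁ dV hdV hdV0 ιA hT lam hlam a' hρ μW
          (piSchwartzBruhatEquiv (↥(maximalRealSubfield L)) (Fin n') (φ ⊗ₜ[ℂ] finSBReindex (↥(maximalRealSubfield L)) e₁ Ψ)) (charCM ξ) μ 2)) =
      MemLp.toLp _ (memLp_toQuotFun_lineThetaLift L 2 H e₁ dV hdV hdV0 ιA hT lam hlam a' hρ μW
          (piSchwartzBruhatEquiv (↥(maximalRealSubfield L)) (Fin n') (φ ⊗ₜ[ℂ] finSBReindex (↥(maximalRealSubfield L)) e₁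
            (finPairRep (↥(maximalRealSubfield L)) L (IsCMField.complexConj L) 2 1 e₁ (Matrix.diagonal dV) (JW (↥(maximalRealSubfield L)) L a')
              (complexConj_imagUnit L) (imagUnit_ne_zero L) (imagUnit_mul_self L) (realDiagonal_isSymm L dV hdV) (isSymm_TW (↥(maximalRealSubfield L)) a')
              (isUnit_det_realDiagonal L dV hdV hdV0) (isUnit_det_TW (↥(maximalRealSubfield L)) a') (realDiagonal_map L dV hdV).symm
              (JW_eq (↥(maximalRealSubfield L)) L a')
              (isCompatible_chiSplittingLine L e₁ dV hdV hdV0 (toHeckeCharacter L lam) (isUnitary_toHeckeCharacter L lam)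
                ((isOscillatorChar_toHeckeCharacter_iff lam).mpr hlam) (TW (↥(maximalRealSubfield L)) a') (isSymm_TW (↥(maximalRealSubfield L)) a')
                (isUnit_det_TW (↥(maximalRealSubfield L)) a') (JW (↥(maximalRealSubfield L)) L a') (JW_eq (↥(maximalRealSubfield L)) L a'))
              ((k : finAdelic (↥(maximalRealSubfield L)) L (IsCMField.complexConj L) 2 (Matrix.diagonal dV)), 1) Ψ))) (charCM ξ) μ 2) := by
    intro hρ μW _ _ φ k Ψ
    have h := rightRegular_finAdelicToAdelic_toLp_lineThetaLift_tmul_finSBReindex L 2 H e₁ dV hdV hdV0 ιA hT lam hlam a' hρ μW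
      (charCM ξ) φ μ t ht g hg hpin
      (finAdelicCongr (↥(maximalRealSubfield L)) L (IsCMField.complexConj L) g ht hg (k : finAdelic (↥(maximalRealSubfield L)) L (IsCMField.complexConj L) 2 (Matrix.diagonal dV))) Ψ
    rw [ContinuousMulEquiv.symm_apply_apply] at h
    rw [hγ]
    exact h
  refine ⟨{Φf | ∀ k ∈ K', finPairRep (↥(maximalRealSubfield L)) L (IsCMField.complexConj L) 2 1 e₁ (Matrix.diagonal dV) (JW (↥(maximalRealSubfield L)) L a')
        (complexConj_imagUnit L) (imagUnit_ne_zero L) (imagUnit_mul_self L) (realDiagonal_isSymm L dV hdV) (isSymm_TW (↥(maximalRealSubfield L)) a')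
        (isUnit_det_realDiagonal L dV hdV hdV0) (isUnit_det_TW (↥(maximalRealSubfield L)) a') (realDiagonal_map L dV hdV).symm
        (JW_eq (↥(maximalRealSubfield L)) L a')
        (isCompatible_chiSplittingLine L e₁ dV hdV hdV0 (toHeckeCharacter L lam) (isUnitary_toHeckeCharacter L lam)
          ((isOscillatorChar_toHeckeCharacter_iff lam).mpr hlam) (TW (↥(maximalRealSubfield L)) a') (isSymm_TW (↥(maximalRealSubfield L)) a')
          (isUnit_det_TW (↥(maximalRealSubfield L)) a') (JW (↥(maximalRealSubfield L)) L a') (JW_eq (↥(maximalRealSubfield L)) L a')) (k, 1)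
          ((finSBReindex (↥(maximalRealSubfield L)) e₁).symm Φf) = (finSBReindex (↥(maximalRealSubfield L)) e₁).symm Φf},
    F.starProjection, hK', ?_, ?_, ?_, ?_⟩
  · -- (i) closed invariant subspaces
    intro Q v hv
    exact starProjection_apply_mem_closedSubrep hU (fun k : K' => γ k) F hF Q hv
  · -- (ii) the image of a pure-tensor class is the class of its finite coset average
    intro hρ μW _ _ φ Φf
    -- the level of `Ψ := (R_e^f)⁻¹ Φ_f` inside `K'`: an open, hence finite-index, subgroup
    obtain ⟨K₁, hK₁o, -, hK₁⟩ := exists_isOpen_isCompact_forall_finPairRep_eq_self L 2 e₁ dV hdV hdV0 lam hlam a'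
      ((finSBReindex (↥(maximalRealSubfield L)) e₁).symm Φf)
    haveI : Finite (K' ⧸ K₁.subgroupOf K') :=
      Subgroup.quotient_finite_of_isOpen (K₁.subgroupOf K') (by
        rw [Subgroup.coe_subgroupOf, Subgroup.coe_subtype]
        exact hK₁o.preimage continuous_subtype_val)
    letI : Fintype (K' ⧸ K₁.subgroupOf K') := Fintype.ofFinite _
    -- the class map is linear in the finite datum
    obtain ⟨Λ, hΛ⟩ : ∃ Λ : FinSB (↥(maximalRealSubfield L)) (Fin 2 × Fin 1) →ₗ[ℂ]
        (adelicGroupData (↥(maximalRealSubfield L)) L (IsCMField.complexConj L) 2 H).L2 μ, ∀ Ψ,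
        Λ Ψ = MemLp.toLp _ (memLp_toQuotFun_lineThetaLift L 2 H e₁ dV hdV hdV0 ιA hT lam hlam a' hρ μW
          (piSchwartzBruhatEquiv (↥(maximalRealSubfield L)) (Fin n') (φ ⊗ₜ[ℂ] finSBReindex (↥(maximalRealSubfield L)) e₁ Ψ)) (charCM ξ) μ 2) :=
      ⟨{ toFun := fun Ψ => MemLp.toLp _ (memLp_toQuotFun_lineThetaLift L 2 H e₁ dV hdV hdV0 ιA hT lam hlam a' hρ μW
            (piSchwartzBruhatEquiv (↥(maximalRealSubfield L)) (Fin n') (φ ⊗ₜ[ℂ] finSBReindex (↥(maximalRealSubfield L)) e₁ Ψ)) (charCM ξ) μ 2)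
         map_add' := fun Ψ₁ Ψ₂ => by
           rw [toLp_lineThetaLift_congr L 2 H e₁ dV hdV hdV0 ιA hT lam hlam a' hρ μW (charCM ξ) μ
             (show piSchwartzBruhatEquiv (↥(maximalRealSubfield L)) (Fin n') (φ ⊗ₜ[ℂ] finSBReindex (↥(maximalRealSubfield L)) e₁ (Ψ₁ + Ψ₂)) =
               piSchwartzBruhatEquiv (↥(maximalRealSubfield L)) (Fin n') (φ ⊗ₜ[ℂ] finSBReindex (↥(maximalRealSubfield L)) e₁ Ψ₁) +
               piSchwartzBruhatEquiv (↥(maximalRealSubfield L)) (Fin n') (φ ⊗ₜ[ℂ] finSBReindex (↥(maximalRealSubfield L)) e₁ Ψ₂) by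
               rw [map_add, TensorProduct.tmul_add, map_add]),
             F0LD2ThetaTensorClasses.toLp_lineThetaLift_add_left L 2 H e₁ dV hdV hdV0 ιA hT lam hlam a' hρ μW (charCM ξ) μ]
         map_smul' := fun c Ψ => by
           rw [toLp_lineThetaLift_congr L 2 H e₁ dV hdV hdV0 ιA hT lam hlam a' hρ μW (charCM ξ) μ
             (show piSchwartzBruhatEquiv (↥(maximalRealSubfield L)) (Fin n') (φ ⊗ₜ[ℂ] finSBReindex (↥(maximalRealSubfield L)) e₁ (c • Ψ)) =
               c • piSchwartzBruhatEquiv (↥(maximalRealSubfield L)) (Fin n') (φ ⊗ₜ[ℂ] finSBReindex (↥(maximalRealSubfield L)) e₁ Ψ) by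
               rw [map_smul, TensorProduct.tmul_smul, map_smul]),
             F0LD2ThetaTensorClasses.toLp_lineThetaLift_smul_left L 2 H e₁ dV hdV hdV0 ιA hT lam hlam a' hρ μW (charCM ξ) μ,
             RingHom.id_apply] }, fun _ => rfl⟩
    -- the orbit representation of `K'` on the finite Schwartz–Bruhat space
    obtain ⟨ρ, hρ'⟩ : ∃ ρ : Representation ℂ K' (FinSB (↥(maximalRealSubfield L)) (Fin 2 × Fin 1)), ∀ (k : K') Ψ, ρ k Ψ =
        finPairRep (↥(maximalRealSubfield L)) L (IsCMField.complexConj L) 2 1 e₁ (Matrix.diagonal dV) (JW (↥(maximalRealSubfield L)) L a')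
          (complexConj_imagUnit L) (imagUnit_ne_zero L) (imagUnit_mul_self L) (realDiagonal_isSymm L dV hdV) (isSymm_TW (↥(maximalRealSubfield L)) a')
          (isUnit_det_realDiagonal L dV hdV hdV0) (isUnit_det_TW (↥(maximalRealSubfield L)) a') (realDiagonal_map L dV hdV).symm
          (JW_eq (↥(maximalRealSubfield L)) L a')
          (isCompatible_chiSplittingLine L e₁ dV hdV hdV0 (toHeckeCharacter L lam) (isUnitary_toHeckeCharacter L lam)
            ((isOscillatorChar_toHeckeCharacter_iff lam).mpr hlam) (TW (↥(maximalRealSubfield L)) a') (isSymm_TW (↥(maximalRealSubfield L)) a')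
            (isUnit_det_TW (↥(maximalRealSubfield L)) a') (JW (↥(maximalRealSubfield L)) L a') (JW_eq (↥(maximalRealSubfield L)) L a'))
          ((k : finAdelic (↥(maximalRealSubfield L)) L (IsCMField.complexConj L) 2 (Matrix.diagonal dV)), 1) Ψ :=
      ⟨(finPairRep (↥(maximalRealSubfield L)) L (IsCMField.complexConj L) 2 1 e₁ (Matrix.diagonal dV) (JW (↥(maximalRealSubfield L)) L a')
          (complexConj_imagUnit L) (imagUnit_ne_zero L) (imagUnit_mul_self L) (realDiagonal_isSymm L dV hdV) (isSymm_TW (↥(maximalRealSubfield L)) a')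
          (isUnit_det_realDiagonal L dV hdV hdV0) (isUnit_det_TW (↥(maximalRealSubfield L)) a') (realDiagonal_map L dV hdV).symm
          (JW_eq (↥(maximalRealSubfield L)) L a')
          (isCompatible_chiSplittingLine L e₁ dV hdV hdV0 (toHeckeCharacter L lam) (isUnitary_toHeckeCharacter L lam)
            ((isOscillatorChar_toHeckeCharacter_iff lam).mpr hlam) (TW (↥(maximalRealSubfield L)) a') (isSymm_TW (↥(maximalRealSubfield L)) a')
            (isUnit_det_TW (↥(maximalRealSubfield L)) a') (JW (↥(maximalRealSubfield L)) L a') (JW_eq (↥(maximalRealSubfield L)) L a'))).comp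
        ((MonoidHom.inl _ _).comp K'.subtype), fun _ _ => rfl⟩
    have hρS : ∀ s ∈ K₁.subgroupOf K', ρ s ((finSBReindex (↥(maximalRealSubfield L)) e₁).symm Φf) =
        (finSBReindex (↥(maximalRealSubfield L)) e₁).symm Φf := fun s hs => by
      rw [hρ']
      exact hK₁ _ (Subgroup.mem_subgroupOf.mp hs)
    have hγS : ∀ s ∈ K₁.subgroupOf K', (adelicGroupData (↥(maximalRealSubfield L)) L (IsCMField.complexConj L) 2 H).rightRegular μ (γ s)
        (Λ ((finSBReindex (↥(maximalRealSubfield L)) e₁).symm Φf)) = Λ ((finSBReindex (↥(maximalRealSubfield L)) e₁).symm Φf) := fun s hs => by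
      rw [hΛ, hequiv hρ μW φ s, hK₁ _ (Subgroup.mem_subgroupOf.mp hs)]
    refine ⟨finSBReindex (↥(maximalRealSubfield L)) e₁ (((Fintype.card (K' ⧸ K₁.subgroupOf K') : ℂ))⁻¹ •
        ∑ q : K' ⧸ K₁.subgroupOf K', ρ q.out ((finSBReindex (↥(maximalRealSubfield L)) e₁).symm Φf)), ?_, ?_⟩
    · -- the coset average has level `K'`
      rw [Set.mem_setOf_eq]
      intro k hk
      rw [LinearEquiv.symm_apply_apply]
      exact (hρ' ⟨k, hk⟩ _).symm.trans (apply_orbitAverage_eq ρ (K₁.subgroupOf K') hρS _ ⟨k, hk⟩)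
    · -- `P_F [θ_{φ ⊗ Φ_f}] = [θ_{φ ⊗ Φ_f″}]`
      have hv : MemLp.toLp _ (memLp_toQuotFun_lineThetaLift L 2 H e₁ dV hdV hdV0 ιA hT lam hlam a' hρ μW
            (piSchwartzBruhatEquiv (↥(maximalRealSubfield L)) (Fin n') (φ ⊗ₜ[ℂ] Φf)) (charCM ξ) μ 2) =
          Λ ((finSBReindex (↥(maximalRealSubfield L)) e₁).symm Φf) := by
        rw [hΛ, LinearEquiv.apply_symm_apply]
      rw [hv, starProjection_eq_orbitAverage hU γ F hF (K₁.subgroupOf K') hγS, ← hΛ, map_smul, map_sum]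
      refine congr_arg _ (Finset.sum_congr rfl fun q _ => ?_)
      rw [hΛ, hΛ, hequiv hρ μW φ q.out, hρ']
  · -- (iii) a class of level `S` is fixed
    intro hρ μW _ _ φ Φf hΦf
    rw [Set.mem_setOf_eq] at hΦf
    rw [Submodule.starProjection_eq_self_iff, hF]
    intro k
    rw [← (finSBReindex (↥(maximalRealSubfield L)) e₁).apply_symm_apply Φf, hequiv hρ μW φ k, hΦf k k.2]
  · -- (iv) the Hermite slices over `S` are finite-dimensional
    intro hρ μW _ _ β
    have hfd := finiteDimensional_span_toLp_lineThetaLift_tmul_of_fixed L 2 H e₁ dV hdV hdV0 ιA hT lam hlam a' hρ μW μ hn' ξ K' hK'o hK'c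
      (follandHermite (frameV L e₁ dV hdV hdV0 (lineW L (TW (Fp L) a')) (complexConj_lineW L (TW (Fp L) a'))
        (lineW_ne_zero L (TW (Fp L) a') (isUnit_det_TW (Fp L) a'))) β)
    refine @Submodule.finiteDimensional_of_le _ _ _ _ _ _ _ hfd (Submodule.span_mono ?_)
    rintro v ⟨Φf, hΦf, rfl⟩
    exact ⟨(finSBReindex (↥(maximalRealSubfield L)) e₁).symm Φf, hΦf, by rw [LinearEquiv.apply_symm_apply]⟩

end Summit.HodgeConjecture.HodgeConjecture.Cruxes.HLiu418.F0LD1ThetaSliceFiniteLevel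

end
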